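import Summits.CriticalPhenomena.PercolationContinuityZ3.Theorems.Transplant.SkelPhiCellsWeakGS
import Summits.CriticalPhenomena.PercolationContinuityZ3.Theorems.Transplant.SkelPhiCellsWeakG
import Summits.CriticalPhenomena.PercolationContinuityZ3.Theorems.Transplant.PlanarCells2FaceRowsS
import Summits.CriticalPhenomena.PercolationContinuityZ3.Theorems.Transplant.PlanarCells2FaceRows2
import Summits.CriticalPhenomena.PercolationContinuityZ3.Theorems.Transplant.SkelPhiCellsWeakGLevelsS
import Summits.CriticalPhenomena.PercolationContinuityZ3.Theorems.Transplant.PlanarCells2BoundsS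
import Summits.CriticalPhenomena.PercolationContinuityZ3.Theorems.Transplant.SkelPhiFaceRegionN
import Literature.Probability.Percolation.OrientedHistorySiteRenormalizationRun
import HarnessLib

/-!
# N2 (frames-only node `SamePDropOfSkeletonFrm₁`, OPEN) — WAVE 1, (F) face-data column over STAGGERED cells ((R-22) `PCells2S`, (R-28)(β) one landing per file): the twin of N1's `SkelPhiFaceRegionN`

builds on p205010 (kernel theorem, internal audit signed; external expert review pending) — nothing in this file uses p205010; NOTHING is claimed about the
open node `SamePDropOfSkeletonFrm₁` (`SamePDropOfSkeletonNeg₁` is CLOSED in the tree and untouched by this file).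
Status sentence (coordinator 2026-08-20T04:30Z): "θ(p_c) = 0 on ℤ^d, all d ≥ 2 — kernel-verified (Lean 4/Mathlib, standard axioms); internal adversarial
audit SIGNED 2026-08-20 04:29Z; external expert review pending."
Lane `prim-bschramm`, seat `prim-hp-8` (gen 40); helper file (`--supports stmt-CriticalPhenomena-4575 --as helper`); design owner p3-g15 ((R-22) staggered
cells `PCells2S`, (R-27)/(R-29) far regions of record `FarNS/FarNS₂`, (R-28)(β), naming 2026-08-22T23:00:04Z: suffix `S`).
PORT RULES (HOME/prim-hp-8/code/gen40/orient/bin/port_s.py = stmt-g19's port_orient.py + the G token table): the cells are `P : PCells2S`, every box is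
read about the STAGGERED centre `cenS` (`PlanarCells2SDefs/SFar/ContainS/SArm/SepS/SepInfS/LevelsS/EfarN2S`), the scheme record is `cellGeomSG₂S`/`cellGeomSG₂bS`
(`SkelPhiCellsWeakGS/…SmallMS`: narrow arm `BtwNS`, two-block far region `FarNS₂`), the history-site API is the ORIENTED one at `qNE` where it occurs
(`ochoice qNE`, `onwardO`, `Valid₂O`, `IsRun₂O`, …, (R-18)); EVERY declaration is re-declared with the suffix `S` (same namespace). Docstrings/citations are N1's.
N1 HEADER (kept for the reader):
* `Win_farAS₂_subset_Efar (hlip) (hws)` (root neighbour from a weak step, 1-thickening `farAS₂ → EfarN₂`), `M_subset_Win_farAS₂` (`j ≤ K`, `WF2.ME`),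
  `Face_subset_Win_faceRow₂` (the face as a cell-map window), `sep_Q_Win_farAS₂ (hlip)`, `disjoint_Win_farAS₂_Stub`, `disjoint_Win_farAS₂_Ewv`, `Win_farAS₂_subset_Win_farAS`.
[cite: KozmaNitzan2024, §4 p. 26 (E_{v,x}, M_x), p. 27 ((30)), p. 30 (Step III: F^{j+1} and the levels above it), p. 31 (D is a subbox of Ω)]
-/
noncomputable section

open scoped Classical

namespace Summit.CriticalPhenomena.PercolationContinuityZ3.Theorems.Transplant

namespace Skelφ

open Literature.Probability.Percolation Literature.Probability.LatticeModels SimpleGraph KNCells Contour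
open Literature.Probability.Percolation.KozmaNitzan
open Literature.Probability.Percolation.KozmaNitzan.Cells (oth oth_ne sgOf sgOf_sign stepVec_apply_fst stepVec_apply_oth eq_oth_of_ne oth_oth)
open Literature.Barriers.CriticalPhenomena (graphBall graphBall_finite mem_graphBall_self graphBall_mono)
open BoxProdZ2 (ConcRadiiG)

variable {V : Type} [DecidableEq V] {G : SimpleGraph V} [G.LocallyFinite] {ψ : V → Site 2}

variable (P : PCells2S) (w₀ : V) {Λ : ConcRadiiG}

/-- **The face-step window lies in the far region of the fine-cell scheme**: `Win w₀ (farASS₂ x du j) (rE_{a'}(x,du)) ⊆ E^far_{a'}(x, du) = VWin (FarNS₂ …)`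
as soon as `1 ≤ rE_{a'}(x, du)`; the root's neighbour comes from a weak step (no `Steps` of the cell map). [cite: KozmaNitzan2024, §4 p. 31 (D ⊆ Ω)] -/
theorem Win_farAS₂_subset_EfarS (hlip : Lip G ψ) (hws : WeakSteps G ψ) {a' : ℕ} {x : Site 2} {du : MDir} (hE : 1 ≤ Λ.rE a' x du) (j : ℕ) :
    Win G ψ w₀ (P.farASS₂ x du j) (Λ.rE a' x du) ⊆ (cellGeomSG₂S G ψ P w₀ Λ).Efar a' x du := by
  obtain ⟨y₀, hy₀, -⟩ := hws w₀ 0 1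
  exact Win_subset_VWin_of_thicken_of_adj hlip hy₀ (fun _ ht _ h => P.mem_FarNS₂_of_near_farASS₂ ht h) hE

/-- **The true target lies in the face-step window**: `M_{a'}(x + du) ⊆ Win w₀ (farASS₂ x du j) (rE_{a'}(x,du))` (`j ≤ K`, `rM ≤ rE`).
[cite: KozmaNitzan2024, §4 p. 26 (M_x ⊆ E_{v,x})] -/
theorem M_subset_Win_farAS₂S (hW : WF2 P.toPCells2 Λ) {a' : ℕ} (x : Site 2) (du : MDir) {j : ℕ} (_hj : j ≤ P.K) :
    (cellGeomSG₂S G ψ P w₀ Λ).M a' (x + stepVec du) ⊆ Win G ψ w₀ (P.farASS₂ x du j) (Λ.rE a' x du) := by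
  change VWin G ψ w₀ (P.M (x + stepVec du)) (Λ.rM a' (x + stepVec du)) ⊆ _
  exact (VWin_subset_Win w₀ _ _).trans (Win_mono G ψ (P.M_add_stepVec_subset_farASS₂ x du j) (hW.ME a' x du))

/-- **The face `F^{j+1}` lies in the zeroth cell-map window over the shifted face row**: `Face_{a'}(x, du, j+1) ⊆ Win w₀ [faceLo, faceHi] rE`
(the source text of `SkelPhiConcFaceRegion`, scheme-independent). [cite: KozmaNitzan2024, §4 p. 30 (Step III: the source box F^{j+1})] -/
theorem Face_subset_Win_faceRow₂S (hW : WF2 P.toPCells2 Λ) (a' : ℕ) (x : Site 2) (du : MDir) (j : ℕ) :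
    (faceDataSGS G ψ P w₀ Λ).Face a' x du (j + 1) ⊆ Win G ψ w₀ (Finset.Icc (P.faceLo x du j) (P.faceHi x du j)) (Λ.rE a' x du) := by
  intro y hy
  change y ∈ (VStair G ψ w₀ (P.Stub x du (j + 1)) (profS P Λ a' x du)).filter
    (fun y => P.lev du x (ψ y) = 5 * (P.r du.1 : ℤ) + 10 * (P.s du.1 : ℤ) * (j + 1 : ℕ) - 1) at hy
  obtain ⟨hy, hl⟩ := Finset.mem_filter.1 hy
  obtain ⟨hP, hd⟩ := mem_of_mem_VStair hy
  exact (mem_Win G ψ).2 ⟨graphBall_mono G w₀ (hW.ρE a' x du _) hd, P.mem_faceRow_of_mem_Stub hP hl⟩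

/-- The face lies in the face-step window (`j + 1 ≤ K`). [folklore] -/
theorem Face_subset_Win_farAS₂S (hW : WF2 P.toPCells2 Λ) (a' : ℕ) (x : Site 2) (du : MDir) {j : ℕ} (hj : j + 1 ≤ P.K) :
    (faceDataSGS G ψ P w₀ Λ).Face a' x du (j + 1) ⊆ Win G ψ w₀ (P.farASS₂ x du j) (Λ.rE a' x du) :=
  (Face_subset_Win_faceRow₂S P w₀ hW a' x du j).trans (Win_mono G ψ (P.faceRow_subset_farASS₂ x du hj) le_rfl)

omit [DecidableEq V] in
/-- **No `G`-edge from the cube span `Q_a(x)` into the face-step window** (from `Lip`). [cite: KozmaNitzan2024, §4 p. 26 ((29))] -/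
theorem sep_Q_Win_farAS₂S [DecidableEq V] (hlip : Lip G ψ) (a : ℕ) (x : Site 2) (du : MDir) (j R : ℕ) :
    KNCells.Sep G ((cellGeomSG₂S G ψ P w₀ Λ).Q a x) (Win G ψ w₀ (P.farASS₂ x du j) R) :=
  sep_of_sepInf hlip (P.Q_sepInf_farASS₂ x du j) (fun _ ha => φ_mem_of_mem_VWin ha) (fun _ hb => ((mem_Win G ψ).1 hb).2)

/-- The face-step window misses the stub span `Stub_{a'}(x, du, j)`. [folklore] -/
theorem disjoint_Win_farAS₂_StubS (a' : ℕ) (x : Site 2) (du : MDir) {j : ℕ} (hjK : j + 1 ≤ P.K) (R : ℕ) :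
    Disjoint (Win G ψ w₀ (P.farASS₂ x du j) R) ((cellGeomSG₂S G ψ P w₀ Λ).Stub a' x du j) := by
  change Disjoint _ (VStair G ψ w₀ (P.Stub x du j) (profS P Λ a' x du))
  exact Finset.disjoint_left.2 fun y ha hb => Finset.disjoint_left.1 (P.farANS₂_disjoint_Stub x du hjK)
    (P.farASS₂_subset_farANS₂ x du j ((mem_Win G ψ).1 ha).2) (mem_of_mem_VStair hb).1

/-- The face-step window misses `E_{w,v}` of the incoming edge (`du ≠ rev δw`). [folklore] -/
theorem disjoint_Win_farAS₂_EwvS (a : ℕ) (w : Site 2) {δw du : MDir} (hne : du ≠ rev δw) (j R : ℕ) :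
    Disjoint (Win G ψ w₀ (P.farASS₂ (w + stepVec δw) du j) R) ((cellGeomSG₂S G ψ P w₀ Λ).Ewv a w δw) := by
  have h := P.EwvNS_disjoint_FarNS w hne
  rw [PCells2S.EwvNS, Finset.disjoint_union_left] at h
  have hsub : P.farASS₂ (w + stepVec δw) du j ⊆ P.FarNS (w + stepVec δw) du :=
    (P.farASS₂_subset_FarNS₂ _ du j).trans (P.FarNS₂_subset_FarNS _ du)
  change Disjoint _ (VWin G ψ w₀ (P.BtwNS w δw) (Λ.rB a w δw) ∪ VWin G ψ w₀ (P.Q (w + stepVec δw)) (Λ.rQ a (w + stepVec δw)))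
  rw [Finset.disjoint_union_right]
  refine ⟨Finset.disjoint_left.2 fun y ha hb => Finset.disjoint_left.1 h.1.symm (hsub ((mem_Win G ψ).1 ha).2) (φ_mem_of_mem_VWin hb),
    Finset.disjoint_left.2 fun y ha hb => Finset.disjoint_left.1 h.2.symm (hsub ((mem_Win G ψ).1 ha).2) (φ_mem_of_mem_VWin hb)⟩

end Skelφ

end Summit.CriticalPhenomena.PercolationContinuityZ3.Theorems.Transplant

end
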